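import Summits.Ventures.PercRepro.Night2LocalTwoTwoX

/-!
# PercRepro — LEMMA X (second half) and the type `(2, 2)` at `q = 3` (night-2, gen 9)

Continues `Night2LocalTwoTwoX`: pairwise disjoint far pairs number at most `3` (`ρ(G ∖ ⋃𝒬) + #𝒬 ≤ 4`),
three far pairs at one element bound the far pairs by `6`, two far pairs at one element (every element in at
most two) bound them by `7`, and all degrees `≤ 1` bound them by `3`.  Hence a coloop-free shadow set has at
most `7` far preimages (`card_farPre_le_seven_of_coloops_eq_zero`; the theorem needs `8`), and with the pair scheme of
`Night2LocalTwoTwo` the type `(2, 2)` of the `q = 3` case split is a theorem: **`localShadowHall_two_two`** —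
at a rank-`4` flat `G` with `|E ∖ G| = 2` of a loopless matroid whose members all have `|G ∖ cl B| ≥ 2`, the
local form (LI_G) holds.
-/

namespace PercRepro.Shadow

open Finset PerFlat ThmH

variable {α : Type*} [DecidableEq α] {M : Matroid α} [M.Finite]

/-! ## Pairwise disjoint far pairs -/

open scoped Classical in
/-- A family of pairwise disjoint far pairs `𝒬`: `ρ(G ∖ ⋃𝒬) + #𝒬 ≤ 4`. -/
theorem rkN_sdiff_biUnion_add_card_le {G : Finset α} (hG : G ∈ flatsQ M 4) {S : Finset α}
    (𝒬 : Finset (Finset α)) (h𝒬 : 𝒬 ⊆ farPairs M 3 G S)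
    (hdisj : ∀ P ∈ 𝒬, ∀ P' ∈ 𝒬, P ≠ P' → Disjoint P P') :
    rkN M (G \ 𝒬.biUnion id) + 𝒬.card ≤ 4 := by
  have hGr : rkN M G = 4 := by unfold rkN; rw [(mem_flatsQ.1 hG).2.2]; rfl
  induction 𝒬 using Finset.induction_on with
  | empty => simp [hGr]
  | insert P 𝒬 hP ih =>
    have h𝒬' : 𝒬 ⊆ farPairs M 3 G S := (Finset.subset_insert _ _).trans h𝒬
    have hdisj' : ∀ Q ∈ 𝒬, ∀ Q' ∈ 𝒬, Q ≠ Q' → Disjoint Q Q' :=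
      fun Q hQ Q' hQ' h => hdisj Q (Finset.mem_insert_of_mem hQ) Q' (Finset.mem_insert_of_mem hQ') h
    have ih' := ih h𝒬' hdisj'
    have hPfar : P ∈ farPairs M 3 G S := h𝒬 (Finset.mem_insert_self _ _)
    have h1 := rkN_sdiff_farPair hPfar
    rw [Finset.biUnion_insert, Finset.card_insert_of_notMem hP]
    have hdisjU : Disjoint (𝒬.biUnion id) P := by
      rw [Finset.disjoint_biUnion_left]
      intro Q hQ
      exact hdisj Q (Finset.mem_insert_of_mem hQ) P (Finset.mem_insert_self _ _) (fun h => hP (h ▸ hQ))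
    have hinter : (G \ 𝒬.biUnion id) ∩ (G \ P) = G \ (id P ∪ 𝒬.biUnion id) := by
      ext e; simp only [Finset.mem_inter, Finset.mem_sdiff, Finset.mem_union, id]; tauto
    have hunion : (G \ 𝒬.biUnion id) ∪ (G \ P) = G := by
      ext e; simp only [Finset.mem_union, Finset.mem_sdiff]
      constructor
      · rintro (h | h) <;> exact h.1
      · intro he
        by_cases heU : e ∈ 𝒬.biUnion id
        · exact Or.inr ⟨he, Finset.disjoint_left.1 hdisjU heU⟩
        · exact Or.inl ⟨he, heU⟩
    have hsub : rkN M ((G \ 𝒬.biUnion id) ∩ (G \ P)) + rkN M ((G \ 𝒬.biUnion id) ∪ (G \ P)) ≤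
        rkN M (G \ 𝒬.biUnion id) + rkN M (G \ P) := rkN_inter_add_rkN_union_le _ _
    rw [hinter, hunion, hGr, h1] at hsub
    omega

open scoped Classical in
/-- At most three pairwise disjoint far pairs. -/
theorem card_le_three_of_pairwise_disjoint (hl : ∀ e ∈ gr M, M.IsNonloop e) {G : Finset α}
    (hG : G ∈ flatsQ M 4) (hd : (gr M \ G).card = 2) {S : Finset α}
    (hS : S ∈ shadowAt M 5 3 (Uq M 5 3) G) (𝒬 : Finset (Finset α)) (h𝒬 : 𝒬 ⊆ farPairs M 3 G S)
    (hdisj : ∀ P ∈ 𝒬, ∀ P' ∈ 𝒬, P ≠ P' → Disjoint P P') : 𝒬.card ≤ 3 := by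
  by_contra hlt
  push Not at hlt
  have h := rkN_sdiff_biUnion_add_card_le hG 𝒬 h𝒬 hdisj
  have hr : rkN M (G \ 𝒬.biUnion id) = 0 := by omega
  obtain ⟨P, hP⟩ : 𝒬.Nonempty := Finset.card_pos.1 (by omega)
  obtain ⟨-, -, B, hB, -, -, -, -⟩ := farPair_facts (h𝒬 hP)
  have hU : 𝒬.biUnion id ⊆ S := by
    intro e he
    rw [Finset.mem_biUnion] at he
    obtain ⟨Q, hQ, heQ⟩ := he
    exact (farPair_facts (h𝒬 hQ)).1 heQ
  exact false_of_rkN_sdiff_eq_zero hl hG hd hS hU hr hB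

/-! ## The count -/

open scoped Classical in
/-- The far pairs containing `a`. -/
noncomputable def pairsAt (M : Matroid α) [M.Finite] (G S : Finset α) (a : α) : Finset (Finset α) :=
  (farPairs M 3 G S).filter (fun P => a ∈ P)

open scoped Classical in
/-- Three far pairs at `a` bound the far pairs by `6`. -/
theorem card_farPairs_le_six (hl : ∀ e ∈ gr M, M.IsNonloop e) {G : Finset α} (hG : G ∈ flatsQ M 4)
    (hd : (gr M \ G).card = 2) {S : Finset α} (hS : S ∈ shadowAt M 5 3 (Uq M 5 3) G)
    (h0 : (coloops M S).card = 0) {a : α} (h3 : 3 ≤ (pairsAt M G S a).card) :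
    (farPairs M 3 G S).card ≤ 6 := by
  obtain ⟨T, hT, hT3⟩ := Finset.exists_subset_card_eq h3
  obtain ⟨P₁, P₂, P₃, h12, h13, h23, rfl⟩ := Finset.card_eq_three.1 hT3
  have hmem : ∀ P ∈ ({P₁, P₂, P₃} : Finset (Finset α)), P ∈ farPairs M 3 G S ∧ a ∈ P := by
    intro P hP
    have := hT hP
    unfold pairsAt at this
    exact Finset.mem_filter.1 this
  -- each `Pᵢ = {a, bᵢ}`
  have hpair : ∀ P ∈ ({P₁, P₂, P₃} : Finset (Finset α)), ∃ b, b ≠ a ∧ P = {a, b} := by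
    intro P hP
    obtain ⟨hPf, haP⟩ := hmem P hP
    obtain ⟨-, hP2, -⟩ := farPair_facts hPf
    obtain ⟨u, v, huv, rfl⟩ := Finset.card_eq_two.1 hP2
    rw [Finset.mem_insert, Finset.mem_singleton] at haP
    rcases haP with rfl | rfl
    · exact ⟨v, huv.symm, rfl⟩
    · exact ⟨u, huv, Finset.pair_comm _ _⟩
  obtain ⟨b, hba, rfl⟩ := hpair P₁ (by simp)
  obtain ⟨c, hca, rfl⟩ := hpair P₂ (by simp)
  obtain ⟨d, hda, rfl⟩ := hpair P₃ (by simp)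
  have hbc : b ≠ c := fun h => h12 (by rw [h])
  have hbd : b ≠ d := fun h => h13 (by rw [h])
  have hcd : c ≠ d := fun h => h23 (by rw [h])
  have hab := (hmem _ (by simp : ({a, b} : Finset α) ∈ ({{a, b}, {a, c}, {a, d}} : Finset (Finset α)))).1
  have hac := (hmem _ (by simp : ({a, c} : Finset α) ∈ ({{a, b}, {a, c}, {a, d}} : Finset (Finset α)))).1
  have had := (hmem _ (by simp : ({a, d} : Finset α) ∈ ({{a, b}, {a, c}, {a, d}} : Finset (Finset α)))).1
  have hsub : farPairs M 3 G S ⊆ Finset.powersetCard 2 ({a, b, c, d} : Finset α) := by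
    intro P hP
    rw [Finset.mem_powersetCard]
    exact ⟨farPair_subset_four hl hG hd hS h0 hab hac had hbc hbd hcd hP, (farPair_facts hP).2.1⟩
  calc (farPairs M 3 G S).card ≤ (Finset.powersetCard 2 ({a, b, c, d} : Finset α)).card :=
        Finset.card_le_card hsub
    _ = Nat.choose ({a, b, c, d} : Finset α).card 2 := Finset.card_powersetCard _ _
    _ ≤ Nat.choose 4 2 := Nat.choose_le_choose 2 (Finset.card_le_four)
    _ = 6 := by decide

/-! ## Two pairs at an element, and the pairwise-disjoint case -/

open scoped Classical in
/-- A far pair `P` disjoint from `W ⊆ S` lowers the rank of the complement: `ρ(G ∖ (W ∪ P)) + 1 ≤ ρ(G ∖ W)`. -/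
theorem rkN_sdiff_union_pair_le {G : Finset α} (hG : G ∈ flatsQ M 4) {S : Finset α} {W : Finset α}
    {P : Finset α} (hP : P ∈ farPairs M 3 G S) (hdisj : Disjoint W P) :
    rkN M (G \ (W ∪ P)) + 1 ≤ rkN M (G \ W) := by
  have h1 := rkN_sdiff_farPair hP
  have hGr : rkN M G = 4 := by unfold rkN; rw [(mem_flatsQ.1 hG).2.2]; rfl
  have hinter : (G \ W) ∩ (G \ P) = G \ (W ∪ P) := by
    ext e; simp only [Finset.mem_inter, Finset.mem_sdiff, Finset.mem_union]; tauto
  have hunion : (G \ W) ∪ (G \ P) = G := by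
    ext e; simp only [Finset.mem_union, Finset.mem_sdiff]
    constructor
    · rintro (h | h) <;> exact h.1
    · intro he
      by_cases heW : e ∈ W
      · exact Or.inr ⟨he, Finset.disjoint_left.1 hdisj heW⟩
      · exact Or.inl ⟨he, heW⟩
  have hsub : rkN M ((G \ W) ∩ (G \ P)) + rkN M ((G \ W) ∪ (G \ P)) ≤ rkN M (G \ W) + rkN M (G \ P) :=
    rkN_inter_add_rkN_union_le _ _
  rw [hinter, hunion, hGr, h1] at hsub
  omega

open scoped Classical in
/-- Two distinct far pairs sharing an element `y`: `ρ(G ∖ (P ∪ P')) ≤ 2`. -/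
theorem rkN_sdiff_union_le_two_of_inter {G : Finset α} (hG : G ∈ flatsQ M 4) {S : Finset α}
    (hS : S ∈ shadowAt M 5 3 (Uq M 5 3) G) (h0 : (coloops M S).card = 0) {P P' : Finset α}
    (hP : P ∈ farPairs M 3 G S) (hP' : P' ∈ farPairs M 3 G S) (hne : P ≠ P') {y : α} (hyP : y ∈ P)
    (hyP' : y ∈ P') : rkN M (G \ (P ∪ P')) ≤ 2 := by
  obtain ⟨-, hP2, -⟩ := farPair_facts hP
  obtain ⟨-, hP'2, -⟩ := farPair_facts hP'
  obtain ⟨u, v, huv, rfl⟩ := Finset.card_eq_two.1 hP2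
  obtain ⟨u', v', huv', rfl⟩ := Finset.card_eq_two.1 hP'2
  -- write `P = {y, p}`, `P' = {y, p'}`
  have hp : ∃ p, p ≠ y ∧ ({u, v} : Finset α) = {y, p} := by
    rw [Finset.mem_insert, Finset.mem_singleton] at hyP
    rcases hyP with rfl | rfl
    · exact ⟨v, huv.symm, rfl⟩
    · exact ⟨u, huv, Finset.pair_comm _ _⟩
  have hp' : ∃ p', p' ≠ y ∧ ({u', v'} : Finset α) = {y, p'} := by
    rw [Finset.mem_insert, Finset.mem_singleton] at hyP'
    rcases hyP' with rfl | rfl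
    · exact ⟨v', huv'.symm, rfl⟩
    · exact ⟨u', huv', Finset.pair_comm _ _⟩
  obtain ⟨p, hpy, hPp⟩ := hp
  obtain ⟨p', hp'y, hP'p⟩ := hp'
  rw [hPp] at hP hne ⊢
  rw [hP'p] at hP' hne ⊢
  have hpp' : p ≠ p' := fun h => hne (by rw [h])
  have h := rkN_three_le_two hG hS h0 hP hP' hpp'
  have : ({y, p} : Finset α) ∪ {y, p'} = {y, p, p'} := by
    ext e; simp only [Finset.mem_union, Finset.mem_insert, Finset.mem_singleton]; tauto
  rw [this]
  exact h

open scoped Classical in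
/-- With `ρ(G ∖ W) ≤ 2` (`W ⊆ S`), two distinct far pairs disjoint from `W` cannot both exist. -/
theorem eq_of_disjoint_of_rkN_le_two (hl : ∀ e ∈ gr M, M.IsNonloop e) {G : Finset α}
    (hG : G ∈ flatsQ M 4) (hd : (gr M \ G).card = 2) {S : Finset α}
    (hS : S ∈ shadowAt M 5 3 (Uq M 5 3) G) (h0 : (coloops M S).card = 0) {W : Finset α} (hW : W ⊆ S)
    (hr : rkN M (G \ W) ≤ 2) {P P' : Finset α} (hP : P ∈ farPairs M 3 G S) (hP' : P' ∈ farPairs M 3 G S)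
    (hdP : Disjoint W P) (hdP' : Disjoint W P') : P = P' := by
  by_contra hne
  obtain ⟨hPS, -, B, hB, -, -, -, -⟩ := farPair_facts hP
  have hP'S : P' ⊆ S := (farPair_facts hP').1
  have h1 := rkN_sdiff_union_pair_le hG hP hdP
  by_cases hmeet : Disjoint P P'
  · -- `ρ(G ∖ (W ∪ P ∪ P')) = 0`
    have h2 := rkN_sdiff_union_pair_le hG hP' (Finset.disjoint_union_left.2 ⟨hdP', hmeet⟩)
    have hr0 : rkN M (G \ (W ∪ P ∪ P')) = 0 := by omega
    exact false_of_rkN_sdiff_eq_zero hl hG hd hS (Finset.union_subset (Finset.union_subset hW hPS) hP'S) hr0 hB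
  · rw [Finset.not_disjoint_iff] at hmeet
    obtain ⟨y, hyP, hyP'⟩ := hmeet
    have h2 := rkN_sdiff_union_le_two_of_inter hG hS h0 hP hP' hne hyP hyP'
    have hGr : rkN M G = 4 := by unfold rkN; rw [(mem_flatsQ.1 hG).2.2]; rfl
    have hinter : (G \ W) ∩ (G \ (P ∪ P')) = G \ (W ∪ (P ∪ P')) := by
      ext e; simp only [Finset.mem_inter, Finset.mem_sdiff, Finset.mem_union]; tauto
    have hunion : (G \ W) ∪ (G \ (P ∪ P')) = G := by
      ext e; simp only [Finset.mem_union, Finset.mem_sdiff]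
      constructor
      · rintro (h | h) <;> exact h.1
      · intro he
        by_cases heW : e ∈ W
        · refine Or.inr ⟨he, ?_⟩
          rintro (h | h)
          · exact Finset.disjoint_left.1 hdP heW h
          · exact Finset.disjoint_left.1 hdP' heW h
        · exact Or.inl ⟨he, heW⟩
    have hsub : rkN M ((G \ W) ∩ (G \ (P ∪ P'))) + rkN M ((G \ W) ∪ (G \ (P ∪ P'))) ≤
        rkN M (G \ W) + rkN M (G \ (P ∪ P')) := rkN_inter_add_rkN_union_le _ _
    rw [hinter, hunion, hGr] at hsub
    have hr0 : rkN M (G \ (W ∪ (P ∪ P'))) = 0 := by omega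
    exact false_of_rkN_sdiff_eq_zero hl hG hd hS (Finset.union_subset hW (Finset.union_subset hPS hP'S)) hr0 hB

open scoped Classical in
/-- Two far pairs at `b` (and every element in at most two far pairs) bound the far pairs by `7`. -/
theorem card_farPairs_le_seven (hl : ∀ e ∈ gr M, M.IsNonloop e) {G : Finset α} (hG : G ∈ flatsQ M 4)
    (hd : (gr M \ G).card = 2) {S : Finset α} (hS : S ∈ shadowAt M 5 3 (Uq M 5 3) G)
    (h0 : (coloops M S).card = 0) (hdeg : ∀ a, (pairsAt M G S a).card ≤ 2) {b : α}
    (h2 : 2 ≤ (pairsAt M G S b).card) : (farPairs M 3 G S).card ≤ 7 := by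
  obtain ⟨T, hT, hT2⟩ := Finset.exists_subset_card_eq h2
  obtain ⟨P₁, P₂, h12, rfl⟩ := Finset.card_eq_two.1 hT2
  have hmem : ∀ P ∈ ({P₁, P₂} : Finset (Finset α)), P ∈ farPairs M 3 G S ∧ b ∈ P := by
    intro P hP
    have := hT hP
    unfold pairsAt at this
    exact Finset.mem_filter.1 this
  have hpair : ∀ P ∈ ({P₁, P₂} : Finset (Finset α)), ∃ x, x ≠ b ∧ P = {b, x} := by
    intro P hP
    obtain ⟨hPf, hbP⟩ := hmem P hP
    obtain ⟨-, hP2, -⟩ := farPair_facts hPf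
    obtain ⟨u, v, huv, rfl⟩ := Finset.card_eq_two.1 hP2
    rw [Finset.mem_insert, Finset.mem_singleton] at hbP
    rcases hbP with rfl | rfl
    · exact ⟨v, huv.symm, rfl⟩
    · exact ⟨u, huv, Finset.pair_comm _ _⟩
  obtain ⟨a, hab, rfl⟩ := hpair P₁ (by simp)
  obtain ⟨c, hcb, rfl⟩ := hpair P₂ (by simp)
  have hac : a ≠ c := fun h => h12 (by rw [h])
  have hba := (hmem _ (by simp : ({b, a} : Finset α) ∈ ({{b, a}, {b, c}} : Finset (Finset α)))).1
  have hbc := (hmem _ (by simp : ({b, c} : Finset α) ∈ ({{b, a}, {b, c}} : Finset (Finset α)))).1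
  have hr := rkN_three_le_two hG hS h0 hba hbc hac
  set W : Finset α := {b, a, c} with hWdef
  have hWS : W ⊆ S := by
    intro e he
    simp only [hWdef, Finset.mem_insert, Finset.mem_singleton] at he
    rcases he with rfl | rfl | rfl
    · exact (farPair_facts hba).1 (by simp)
    · exact (farPair_facts hba).1 (by simp)
    · exact (farPair_facts hbc).1 (by simp)
  -- the far pairs split into those through `a`, `b`, `c` and those disjoint from `W`
  have hsplit : farPairs M 3 G S ⊆ pairsAt M G S a ∪ pairsAt M G S b ∪ pairsAt M G S c ∪
      (farPairs M 3 G S).filter (fun P => Disjoint W P) := by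
    intro P hP
    simp only [Finset.mem_union, pairsAt, Finset.mem_filter]
    by_cases hdisj : Disjoint W P
    · exact Or.inr ⟨hP, hdisj⟩
    · rw [Finset.not_disjoint_iff] at hdisj
      obtain ⟨x, hxW, hxP⟩ := hdisj
      simp only [hWdef, Finset.mem_insert, Finset.mem_singleton] at hxW
      rcases hxW with rfl | rfl | rfl
      · exact Or.inl (Or.inl (Or.inr ⟨hP, hxP⟩))
      · exact Or.inl (Or.inl (Or.inl ⟨hP, hxP⟩))
      · exact Or.inl (Or.inr ⟨hP, hxP⟩)
  have hdisjcard : ((farPairs M 3 G S).filter (fun P => Disjoint W P)).card ≤ 1 := by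
    rw [Finset.card_le_one]
    intro P hP P' hP'
    rw [Finset.mem_filter] at hP hP'
    exact eq_of_disjoint_of_rkN_le_two hl hG hd hS h0 hWS hr hP.1 hP'.1 hP.2 hP'.2
  calc (farPairs M 3 G S).card
      ≤ (pairsAt M G S a ∪ pairsAt M G S b ∪ pairsAt M G S c ∪
          (farPairs M 3 G S).filter (fun P => Disjoint W P)).card := Finset.card_le_card hsplit
    _ ≤ (pairsAt M G S a ∪ pairsAt M G S b ∪ pairsAt M G S c).card +
          ((farPairs M 3 G S).filter (fun P => Disjoint W P)).card := Finset.card_union_le _ _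
    _ ≤ (pairsAt M G S a ∪ pairsAt M G S b).card + (pairsAt M G S c).card +
          ((farPairs M 3 G S).filter (fun P => Disjoint W P)).card := by
        gcongr; exact Finset.card_union_le _ _
    _ ≤ (pairsAt M G S a).card + (pairsAt M G S b).card + (pairsAt M G S c).card +
          ((farPairs M 3 G S).filter (fun P => Disjoint W P)).card := by
        gcongr; exact Finset.card_union_le _ _
    _ ≤ 2 + 2 + 2 + 1 := by
        have ha := hdeg a; have hb := hdeg b; have hc := hdeg c
        omega
    _ = 7 := by norm_num

open scoped Classical in
/-- If every element lies in at most one far pair, the far pairs are pairwise disjoint: at most `3`. -/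
theorem card_farPairs_le_three (hl : ∀ e ∈ gr M, M.IsNonloop e) {G : Finset α} (hG : G ∈ flatsQ M 4)
    (hd : (gr M \ G).card = 2) {S : Finset α} (hS : S ∈ shadowAt M 5 3 (Uq M 5 3) G)
    (hdeg : ∀ a, (pairsAt M G S a).card ≤ 1) : (farPairs M 3 G S).card ≤ 3 := by
  apply card_le_three_of_pairwise_disjoint hl hG hd hS _ (Finset.Subset.refl _)
  intro P hP P' hP' hne
  by_contra hmeet
  rw [Finset.not_disjoint_iff] at hmeet
  obtain ⟨x, hxP, hxP'⟩ := hmeet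
  have h := hdeg x
  unfold pairsAt at h
  rw [Finset.card_le_one] at h
  exact hne (h P (Finset.mem_filter.2 ⟨hP, hxP⟩) P' (Finset.mem_filter.2 ⟨hP', hxP'⟩))

/-! ## LEMMA X and the theorem -/

open scoped Classical in
/-- **LEMMA X.**  A coloop-free shadow set at a rank-`4` flat with `|E ∖ G| = 2` (loopless `M`) has at most `7`
far preimages (the theorem needs `8`). -/
theorem card_farPre_le_seven_of_coloops_eq_zero (hl : ∀ e ∈ gr M, M.IsNonloop e) {G : Finset α}
    (hG : G ∈ flatsQ M 4) (hd : (gr M \ G).card = 2) {S : Finset α}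
    (hS : S ∈ shadowAt M 5 3 (Uq M 5 3) G) (h0 : (coloops M S).card = 0) :
    (farPre M 3 G S).card ≤ 7 := by
  rw [← card_farPairs]
  by_cases h3 : ∃ a, 3 ≤ (pairsAt M G S a).card
  · obtain ⟨a, ha⟩ := h3
    have := card_farPairs_le_six hl hG hd hS h0 ha
    omega
  · push Not at h3
    have hdeg : ∀ a, (pairsAt M G S a).card ≤ 2 := fun a => by have := h3 a; omega
    by_cases h2 : ∃ b, 2 ≤ (pairsAt M G S b).card
    · obtain ⟨b, hb⟩ := h2
      have := card_farPairs_le_seven hl hG hd hS h0 hdeg hb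
      omega
    · push Not at h2
      have hdeg1 : ∀ a, (pairsAt M G S a).card ≤ 1 := fun a => by have := h2 a; omega
      have := card_farPairs_le_three hl hG hd hS hdeg1
      omega

open scoped Classical in
/-- **The type `(2, 2)` at `q = 3`**: at a rank-`4` flat `G` with `|E ∖ G| = 2` of a loopless matroid, if every
member below `G` has `|G ∖ cl B| ≥ 2`, the local form holds. -/
theorem localShadowHall_two_two (hl : ∀ e ∈ gr M, M.IsNonloop e) {G : Finset α} (hG : G ∈ flatsQ M 4)
    (hd : (gr M \ G).card = 2) (hno : ∀ B ∈ membersIn M (Uq M 5 3) G, 2 ≤ (G \ clF M B).card) :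
    LocalShadowHall M 3 G :=
  localShadowHall_two_two_of_far hG hd hno
    (fun _ hS h0 => Nat.le_succ_of_le (card_farPre_le_seven_of_coloops_eq_zero hl hG hd hS h0))

end PercRepro.Shadow
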